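import Summits.BirchSwinnertonDyer.Rank1Residual.Additive.KatoDescentGlobalKummerClass
import Literature.NumberTheory.EllipticCurves.Castella2024.LambdaAdicHeegnerClassExistence
import HarnessLib

set_option autoImplicit false

/-!
# The `T_p`-adic Kummer class of a rational point is a FINITE class: `κ_∞(P) ∈ H¹_f(ℚ, T_pW)`
# (`Kato2004.finiteH1`), and its reductions are a Kummer family in Howard's sense (`IsKummerFamilyOver ⊤`)
# (seat `bsd-cm-prr-ty1` g9, cell `bsd-cm`; theorems only: no definition, no named fact, no instance, no `sorry`)

Part 13 of the seat's kernel cut of stub 3 `stub_rankOneCountReadingKato` of the Kato–Perrin-Riou skeletons v4 (cruxes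
stmt-BirchSwinnertonDyer-19945 / -19223; = cell bsd-potss's held input 27322). Part 12
(`KatoDescentGlobalKummerClass`) built, for `P ∈ W(ℚ)`, the class `κ_∞(P) ∈ H¹(⊤, T_pW)` with
`ofTop(red_{p^k} κ_∞(P)) = κ_{p^k}(P)` for all `k` and `HasLocPKummerLog W p κ_∞(P) (log_ω P)`, in the Γ_ℚ-typing of
the tree's Kummer maps `kummerMapTorsion`. The tree ALSO carries Howard's compact-Selmer currency on a subgroup
`H ≤ Γ_K`: Kummer classes `WeierstrassCurve.kummerClassOver H m Q`, Kummer FAMILIES `IsKummerFamilyOver`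
(`AnticyclotomicCompactSelmer`), their membership in Perrin-Riou's compact Selmer group `compactSelmerOver`
(`IsKummerFamilyOver.mem_compactSelmerOver`, `Castella2024/LambdaAdicHeegnerClassExistence`), and Kato's
`H¹_f(F, T_pW) = Kato2004.finiteH1` (preimage of `compactSelmerOver` under `reducePi`). THIS FILE bridges the two
currencies and draws the consequence:

* §1 (any field, any subgroup `H`) `resSubgroup_kummerClassTorsion_eq_kummerClassOver` — the restriction to `H` of
  the `Γ_K`-Kummer class `kummerClassTorsion W m Q` IS Howard's `kummerClassOver H m Q` (same cocycle `σ ↦ σQ − Q`).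
* §2 (`K = ℚ`) `reduceH1Pk_eq_resSubgroup_of_ofTopSubgroup_eq` — the `ofTop`-form of Part 12's characterisation
  implies the `⊤`-form `red_{p^k} x = κ_{p^k}(P)|_⊤`; `isKummerFamilyOver_reducePi` — the reductions
  `reducePi x = (red_{p^k} x)_k` of such an `x` are a KUMMER FAMILY of the point `P` over `⊤`;
  **`mem_finiteH1_of_forall_eq`** — hence `x ∈ H¹_f(ℚ, T_pW)` (`Kato2004.finiteH1 W p ⊤`): the `T_p`-adic Kummer
  class of a rational point is a finite (Selmer) class at EVERY place — Kato §14.1 «the image of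
  `E(ℚ) ⊗ ℤ_p → H¹(ℤ[1/p], T)` is contained in `H¹_f`», Bloch–Kato Ex. 3.11.
* §3 packages: `exists_kummerTate_mem_finiteH1_hasLocPKummerLog` and the additive
  `exists_addMonoidHom_kummerTate_mem_finiteH1` — `κ_∞ : W(ℚ) →+ H¹(⊤, T_pW)` with levels `κ_{p^k}`, values in
  `H¹_f(ℚ, T_pW)`, and `HasLocPKummerLog W p (κ_∞ P) (log_ω P)`.

USE (COUNT-EC⁰ lane): `H¹_f(ℚ, T_pW)` is the group whose index computations (`[H¹_f : ℤ_p z]`, potss's A-side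
ledger `KatoDescentPotSupersingularASide…`, and `[A : ℤ_p κ_∞(P)]` in rank one) carry the Tamagawa and torsion
factors of COUNT-EC⁰; this file places `κ_∞(P)` inside it.

HONEST LABEL: theorems only; no stub or item is closed; nothing is registered; nothing is asserted on 19945 / 19223;
Kato's Main Conjecture and Perrin-Riou's conjecture are not touched; BSD is not proved for any curve.

References: [Kato2004Asterisque] §14.1 (pp. 234–235); [BlochKato1990] Def. 3.10 and Ex. 3.11; [PerrinRiou1987BSMF] §0
(p. 401); [Howard2004HeegnerKolyvagin] §1 (the compact Kummer map `E(L) ⊗ ℤ_p → S_p(E/L)`); [SilvermanAEC2009]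
VIII.§2, X.§4 Thm. 4.2; [Rubin2000] App. B Prop. B.2.3; [SerreGaloisCohomology1997] I §2.4.
-/

noncomputable section

open scoped Classical NumberField ContRepresentation

open WeierstrassCurve Field IsDedekindDomain CategoryTheory Literature.NumberTheory.EllipticCurves
  Literature.NumberTheory.EllipticCurves.Kato2004 Literature.NumberTheory.GaloisRepresentations
  Literature.NumberTheory.EllipticCurves.Kato2004.EulerSystemValues
open WeierstrassCurve (geomPoints geomTorsion galH1Torsion)

universe u

namespace Summit.BirchSwinnertonDyer.Rank1Residual.Additive.GlobalKummer

/-! ## §1 The two Kummer-class currencies agree on a subgroup -/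

section Currency

variable {K : Type u} [Field K] (W : WeierstrassCurve K) (H : Subgroup (absoluteGaloisGroup K))

/-- **`κ_m(Q)|_H = kummerClassOver H m Q`**: the restriction to `H ≤ Γ_K` (`resSubgroup`) of the `Γ_K`-Kummer class
`kummerClassTorsion W m Q` of a point `Q ∈ W(K̄)` with `m • Q ∈ W(K)` is Howard's Kummer class of `Q` over `H` —
both are the class of the cocycle `σ ↦ σQ − Q` on `H`. [cite: SilvermanAEC2009, VIII.§2 (p. 191)]
[cite: Howard2004HeegnerKolyvagin, §1 (the compact Kummer map)] -/
theorem resSubgroup_kummerClassTorsion_eq_kummerClassOver (m : ℤ) (Q : geomPoints W)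
    (hQ : m • Q ∈ MulAction.fixedPoints (absoluteGaloisGroup K) (geomPoints W)) :
    resSubgroup (W.torsionGaloisModule m).toTopRep H 1 (kummerClassTorsion W m Q hQ) =
      W.kummerClassOver H m Q (fun σ _ ↦ hQ σ) := by
  refine (map_oneCocycleClass _ _ _ _).trans ?_
  exact congrArg _ (Subtype.ext (ContinuousMap.ext fun _ ↦ Subtype.ext rfl))

/-- **`κ_m(P)|_H = kummerClassOver H m Q` for ANY root `Q`, `m • Q = P`** (the Kummer map does not depend on the
root). [cite: SilvermanAEC2009, VIII.§2 (p. 191)] [cite: Howard2004HeegnerKolyvagin, §1] -/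
theorem resSubgroup_kummerMapTorsion_eq_kummerClassOver (m : ℤ)
    (hdiv : ∀ P : geomPoints W, ∃ Q : geomPoints W, m • Q = P) (P : W.toAffine.Point) (Q : geomPoints W)
    (hQ : m • Q = toGeomPoints W P) :
    resSubgroup (W.torsionGaloisModule m).toTopRep H 1 (kummerMapTorsion W m hdiv P) =
      W.kummerClassOver H m Q (fun σ _ ↦ by rw [hQ]; exact toGeomPoints_mem_fixedPoints W P σ) := by
  rw [kummerMapTorsion_apply, kummerMapTorsionFun_eq W m hdiv P Q hQ]
  exact resSubgroup_kummerClassTorsion_eq_kummerClassOver W H m Q _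

end Currency

/-! ## §2 `κ_∞(P)` is a Kummer family over `⊤` and a finite class -/

section Finite

variable (W : WeierstrassCurve ℚ) [W.IsElliptic] (p : ℕ) [Fact p.Prime] [ContinuousSMul ℤ_[p] (W.tateModule p)]

/-- From the `ofTop`-form to the `⊤`-form: if `ofTop(red_{p^k} x) = κ_{p^k}(P)` then `red_{p^k} x = κ_{p^k}(P)|_⊤`
(`ofTop` is injective and `ofTop ∘ res_⊤ = id`). [cite: SerreGaloisCohomology1997, I §2.4] -/
theorem reduceH1Pk_eq_resSubgroup_of_ofTopSubgroup_eq
    (hdiv : ∀ (k : ℕ) (P : geomPoints W), ∃ Q : geomPoints W, ((p : ℤ) ^ k) • Q = P) {P : W.toAffine.Point}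
    {x : H1 (tateRep W p) ⊤}
    (hx : ∀ k : ℕ,
      (ofTopSubgroup (W.torsionGaloisModule ((p : ℤ) ^ k)).toTopRep 1).hom (reduceH1Pk W p k ⊤ x) =
        kummerMapTorsion W ((p : ℤ) ^ k) (hdiv k) P) (k : ℕ) :
    reduceH1Pk W p k ⊤ x =
      resSubgroup (W.torsionGaloisModule ((p : ℤ) ^ k)).toTopRep ⊤ 1 (kummerMapTorsion W ((p : ℤ) ^ k) (hdiv k) P) := by
  rw [← sub_eq_zero]
  refine eq_zero_of_ofTopSubgroup_eq_zero (W.torsionGaloisModule ((p : ℤ) ^ k)).toTopRep _ ?_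
  rw [map_sub, hx k, ofTopSubgroup_hom_resSubgroup_top, sub_self]

/-- **The reductions of `κ_∞(P)` are a KUMMER FAMILY of `P` over `⊤`** (Howard's `IsKummerFamilyOver`, the tree's
compact-Selmer currency): `red_{p^k} x = kummerClassOver ⊤ (p^k) Q` for every root `Q`, `p^k Q = P`.
[cite: Howard2004HeegnerKolyvagin, §1 (the compact Kummer map `E(L) ⊗ ℤ_p → S_p(E/L)`)]
[cite: Kato2004Asterisque, §14.1 (p. 235)] -/
theorem isKummerFamilyOver_reducePi
    (hdiv : ∀ (k : ℕ) (P : geomPoints W), ∃ Q : geomPoints W, ((p : ℤ) ^ k) • Q = P) {P : W.toAffine.Point}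
    {x : H1 (tateRep W p) ⊤}
    (hx : ∀ k : ℕ,
      (ofTopSubgroup (W.torsionGaloisModule ((p : ℤ) ^ k)).toTopRep 1).hom (reduceH1Pk W p k ⊤ x) =
        kummerMapTorsion W ((p : ℤ) ^ k) (hdiv k) P) :
    W.IsKummerFamilyOver p ⊤ (P := toGeomPoints W P) (fun σ _ ↦ toGeomPoints_mem_fixedPoints W P σ)
      (reducePi W p ⊤ x) := by
  intro k Q hQ
  rw [reducePi_apply, ← reduceH1Pk_apply_eq_reduceH1Pow,
    reduceH1Pk_eq_resSubgroup_of_ofTopSubgroup_eq W p hdiv hx k]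
  exact resSubgroup_kummerMapTorsion_eq_kummerClassOver W ⊤ _ (hdiv k) P Q hQ

/-- **`κ_∞(P) ∈ H¹_f(ℚ, T_pW)`**: a class `x ∈ H¹(⊤, T_pW)` with `ofTop(red_{p^k} x) = κ_{p^k}(P)` for all `k` lies
in Kato's finite part `Kato2004.finiteH1 W p ⊤` — its reductions are a Kummer family, Kummer families lie in
Perrin-Riou's compact Selmer group (`IsKummerFamilyOver.mem_compactSelmerOver`: Kummer classes satisfy every local
condition, AEC X.4.2), and `finiteH1` is the preimage of the compact Selmer group under `reducePi`. Kato §14.1: the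
image of `E(ℚ) ⊗ ℤ_p` lies in `H¹_f`. [cite: Kato2004Asterisque, §14.1 (pp. 234–235)] [cite: BlochKato1990, Ex. 3.11]
[cite: SilvermanAEC2009, X.§4 Thm. 4.2] [cite: PerrinRiou1987BSMF, §0 (p. 401)] -/
theorem mem_finiteH1_of_forall_eq
    (hdiv : ∀ (k : ℕ) (P : geomPoints W), ∃ Q : geomPoints W, ((p : ℤ) ^ k) • Q = P) {P : W.toAffine.Point}
    {x : H1 (tateRep W p) ⊤}
    (hx : ∀ k : ℕ,
      (ofTopSubgroup (W.torsionGaloisModule ((p : ℤ) ^ k)).toTopRep 1).hom (reduceH1Pk W p k ⊤ x) =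
        kummerMapTorsion W ((p : ℤ) ^ k) (hdiv k) P) :
    x ∈ finiteH1 W p ⊤ :=
  (isKummerFamilyOver_reducePi W p hdiv hx).mem_compactSelmerOver

end Finite

/-! ## §3 Packages -/

section Package

variable (W : WeierstrassCurve ℚ) [W.IsElliptic] (p : ℕ) [Fact p.Prime] [ContinuousSMul ℤ_[p] (W.tateModule p)]

/-- **THE `T_p`-ADIC KUMMER CLASS OF `P`: levels, finiteness, logarithm** — for `W/ℚ` globally minimal, any prime
`p` and `P ∈ W(ℚ)` there is `x ∈ H¹(⊤, T_pW)` with `ofTop(red_{p^k} x) = κ_{p^k}(P)` for all `k`,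
`x ∈ H¹_f(ℚ, T_pW)`, and `HasLocPKummerLog W p x (log_ω P)`. [cite: Kato2004Asterisque, §14.1 (pp. 234–235)]
[cite: BlochKato1990, Ex. 3.11] [cite: Rubin2000, App. B Prop. B.2.3] -/
theorem exists_kummerTate_mem_finiteH1_hasLocPKummerLog [W.IsGloballyMinimal] (P : W.toAffine.Point) :
    ∃ x : H1 (tateRep W p) ⊤,
      (∀ k : ℕ,
        (ofTopSubgroup (W.torsionGaloisModule ((p : ℤ) ^ k)).toTopRep 1).hom (reduceH1Pk W p k ⊤ x) =
          kummerMapTorsion W ((p : ℤ) ^ k)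
            (fun R ↦ zsmul_geomPoints_surjective_holds W
              (pow_ne_zero k (Int.natCast_ne_zero.mpr (Fact.out : p.Prime).ne_zero)) R) P) ∧
      x ∈ finiteH1 W p ⊤ ∧
      HasLocPKummerLog W p x
        (padicLogLocal W p (Affine.Point.map (W' := W.toAffine) (S := ℚ) (Algebra.ofId ℚ ℚ_[p]) P)) := by
  obtain ⟨x, hx, hlog⟩ := exists_kummerTate_hasLocPKummerLog W p P
  exact ⟨x, hx, mem_finiteH1_of_forall_eq W p _ hx, hlog⟩

/-- **THE COMPACT KUMMER MAP `κ_∞ : W(ℚ) →+ H¹(⊤, T_pW)` with values in `H¹_f(ℚ, T_pW)` and its logarithms**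
(`W/ℚ` globally minimal, any prime `p`): additive, levels `κ_{p^k}(P)`, `κ_∞(P) ∈ Kato2004.finiteH1 W p ⊤`, and
`HasLocPKummerLog W p (κ_∞ P) (log_ω P)` for every `P`. Kato's `E(ℚ) ⊗ ℤ_p → H¹_f ⊂ H¹(ℤ[1/p], T) ⊂ H¹(ℚ, T)` in the
tree's finite-level currency. [cite: Kato2004Asterisque, §14.1 (pp. 234–235)] [cite: BlochKato1990, Ex. 3.11]
[cite: Howard2004HeegnerKolyvagin, §1] -/
theorem exists_addMonoidHom_kummerTate_mem_finiteH1 [W.IsGloballyMinimal] :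
    ∃ κ : W.toAffine.Point →+ H1 (tateRep W p) ⊤,
      (∀ (P : W.toAffine.Point) (k : ℕ),
        (ofTopSubgroup (W.torsionGaloisModule ((p : ℤ) ^ k)).toTopRep 1).hom (reduceH1Pk W p k ⊤ (κ P)) =
          kummerMapTorsion W ((p : ℤ) ^ k)
            (fun R ↦ zsmul_geomPoints_surjective_holds W
              (pow_ne_zero k (Int.natCast_ne_zero.mpr (Fact.out : p.Prime).ne_zero)) R) P) ∧
      (∀ P : W.toAffine.Point, κ P ∈ finiteH1 W p ⊤) ∧
      ∀ P : W.toAffine.Point, HasLocPKummerLog W p (κ P)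
        (padicLogLocal W p (Affine.Point.map (W' := W.toAffine) (S := ℚ) (Algebra.ofId ℚ ℚ_[p]) P)) := by
  obtain ⟨κ, hκ, hlog⟩ := exists_addMonoidHom_kummerTate_hasLocPKummerLog W p
  exact ⟨κ, hκ, fun P ↦ mem_finiteH1_of_forall_eq W p _ (hκ P), hlog⟩

end Package

end Summit.BirchSwinnertonDyer.Rank1Residual.Additive.GlobalKummer

end
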